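import Literature.Probability.LatticeModels.TorusTwoPointDecay
import HarnessLib

/-!
# The rotated torus `ℤ^d / ⟨N(e₀+e₁), N(e₀−e₁), Ne₂, …⟩`: a periodic approximation adapted to a diagonal

Topic `Literature/Probability/LatticeModels`; family `crit-ising`. No named fact, no sorry. Definitions:
the rotated torus `RotSite d'' N = ℤ/2Nℤ × (ℤ/Nℤ)^{d''+1}` (coordinates `(x₀+x₁, (x₁, x₂, …))`), the
projection `rotProj` (an additive homomorphism `ℤ^{d''+2} → RotSite`), its nearest-neighbour graph
`rotGraph` (a circulant graph, the quotient of the nearest-neighbour graph of `ℤ^{d''+2}` by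
`Γ_rot = ⟨N(e₀+e₁), N(e₀−e₁), Ne₂, …, Ne_{d''+1}⟩`), the periodic two-point function `rotTwoPoint` and
the quotient sup-norm `rotNorm`.

## Why

Aizenman–Duminil-Copin 2021, Prop. 5.4, *third item* (the monotonicity of
`Ŝ^{mod}(p) = Ŝ(p) + Ŝ(p + π(1,1,0,…))` along anti-diagonals, arXiv:1912.07973 p. 18; Panis 2023,
Prop. 3.16) is proved through "the transfer matrix in the diagonal direction … one may start by
considering a partially rotated rectangular region, whose main axes are associated with the coordinate
system `(x₁+x₂, x₁−x₂, x₃, …, x_d)` … with the correspondingly modified periodic boundary conditions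
which produce cyclicity in these directions. As stated in (FTconv), for `β < β_c(ρ)` the change does
not affect the two-point function's infinite volume limit." On the standard torus `(ℤ/Nℤ)^d` the
diagonal transfer structure is twisted (the even diagonal layers close up after `N/2` two-steps only
modulo the translation by `(N/2)(e₀+e₁)`, and reflection positivity through diagonal planes fails), so
these volumes are genuinely needed. This file provides them together with the two facts that make
their two-point function a legitimate approximation of the infinite-volume one at `β < β_c`:

* `abs_rotTwoPoint_sub_plusCorr_le` — **convergence** `⟨σ_{x̄}σ_{ȳ}⟩^{rot}_{N;β} → ⟨σ_xσ_y⟩_β` when the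
  free and plus states agree (Griffiths sandwich `free box ≤ rotated torus ≤ plus box`,
  `isingTwoPoint_free_box_le_rotTwoPoint`, `rotTwoPoint_le_isingCorr_plus_box`, through the free and
  plus transport lemmas of `IsingTransport` / `TorusZeroMode` along the embedding of a box, injective
  for `2M + 4 ≤ N`);
* `rotTwoPoint_le_dctIsingPhi_pow`, `exists_uniform_decay_rotTwoPoint` — **uniform exponential
  decay** (the modified Simon inequality of Duminil-Copin–Tassion 2016, Lemma 2.7, valid on every
  finite graph, iterated with the quotient sup-norm `rotNorm`; below `β_c` some box has `φ_β(Λ_R) < 1`,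
  `exists_dctIsingPhi_box_lt_one_of_lt_criticalBeta` of `TorusTwoPointDecay`), on the representative
  domain `|x₀| ≤ N`, `2|x_j| ≤ N` (`j ≥ 1`), where `‖x‖_∞ ≤ 2|x̄|_rot` (`supNorm_le_two_mul_rotNorm`, from
  the structure of `Γ_rot`).

The transfer-matrix analysis in the diagonal direction and the limit `N → ∞` are the business of the
sequel files. (Step V4a of the tree's programme towards ADC Thm 5.6,
`aizenmanDuminilCopin_slidingScaleInfraredBound`.)

## References

* M. Aizenman, H. Duminil-Copin, Ann. of Math. 194 (2021) = arXiv:1912.07973, Prop. 5.2 and proof of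
  Prop. 5.4 (p. 17–18) [AizenmanDuminilCopinAnnals2021].
* H. Duminil-Copin, V. Tassion, Comm. Math. Phys. 343 (2016), Lemma 2.7, §2.5 [DuminilCopinTassionCMP2016].
* S. Friedli, Y. Velenik (2017), §3.1, Exercise 3.12 [FriedliVelenik2017].

## Mathlib

`SimpleGraph.circulantGraph`, `AddMonoidHom`, `ZMod.intCast_zmod_eq_zero_iff_dvd`,
`Int.eq_zero_of_abs_lt_dvd`, `Nat.find`; the tree's `Site.supNorm`, `box`, `isingTwoPoint`,
`isingTwoPoint_free_le_modifiedSimon`, `dctIsingPhi`.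
-/

noncomputable section

open MeasureTheory Filter Topology Finset

namespace Literature.Probability.LatticeModels

/-! ### Part 1. The rotated torus and its nearest-neighbour graph -/

section Graph

variable {d'' : ℕ}

/-- `2N ≠ 0` for `N ≠ 0`. [folklore] -/
instance instNeZeroTwoMul (N : ℕ) [NeZero N] : NeZero (2 * N) := ⟨by have := NeZero.ne N; omega⟩

variable (d'') in
/-- A site of the **rotated torus** `ℤ^{d''+2}/Γ_rot`, `Γ_rot = ⟨N(e₀+e₁), N(e₀-e₁), Ne₂, …, Ne_{d''+1}⟩`,
in the coordinates `(a, (b, z)) = (x₀ + x₁ mod 2N, (x₁, x₂, …) mod N)`: the finite abelian group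
`ℤ/2Nℤ × (ℤ/Nℤ)^{d''+1}` (Aizenman–Duminil-Copin 2021, proof of Prop. 5.4: "a partially rotated
rectangular region, whose main axes are associated with the coordinate system `(x₁+x₂, x₁−x₂, x₃, …)`
… with the correspondingly modified periodic boundary conditions"). [cite: AizenmanDuminilCopinAnnals2021, arXiv:1912.07973 proof of Prop. 5.4 (iii) (p. 18)] -/
abbrev RotSite (N : ℕ) : Type := ZMod (2 * N) × TorusSite (d'' + 1) N

variable (d'') in
/-- The projection `ℤ^{d''+2} → ℤ/2Nℤ × (ℤ/Nℤ)^{d''+1}`, `x ↦ (x₀ + x₁, (x₁, x₂, …, x_{d''+1}))`, an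
additive homomorphism with kernel `Γ_rot`. [cite: AizenmanDuminilCopinAnnals2021, arXiv:1912.07973 proof of Prop. 5.4 (iii) (p. 18)] -/
def rotProj (N : ℕ) : Site (d'' + 2) →+ RotSite d'' N where
  toFun x := (((x 0 + x 1 : ℤ) : ZMod (2 * N)), fun j => ((x j.succ : ℤ) : ZMod N))
  map_zero' := by simp; rfl
  map_add' x y := by
    ext j
    · simp; ring_nf
    · simp

/-- First coordinate of the projection: `x₀ + x₁ mod 2N`. [folklore] -/
theorem rotProj_apply_fst (N : ℕ) (x : Site (d'' + 2)) : (rotProj d'' N x).1 = ((x 0 + x 1 : ℤ) : ZMod (2 * N)) := rfl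

/-- Remaining coordinates of the projection: `x_{j+1} mod N`. [folklore] -/
theorem rotProj_apply_snd (N : ℕ) (x : Site (d'' + 2)) (j : Fin (d'' + 1)) :
    (rotProj d'' N x).2 j = ((x j.succ : ℤ) : ZMod N) := rfl

variable (d'') in
/-- The **nearest-neighbour graph of the rotated torus**: the circulant graph on
`ℤ/2Nℤ × (ℤ/Nℤ)^{d''+1}` with jumps the images of the unit vectors, i.e. the quotient of the
nearest-neighbour graph of `ℤ^{d''+2}` by `Γ_rot`. [cite: AizenmanDuminilCopinAnnals2021, arXiv:1912.07973 proof of Prop. 5.4 (iii) (p. 18)] -/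
def rotGraph (N : ℕ) : SimpleGraph (RotSite d'' N) :=
  SimpleGraph.circulantGraph (Set.range fun i : Fin (d'' + 2) => rotProj d'' N (Pi.single i 1))

/-- Adjacency on the rotated torus, unfolded. [folklore] -/
theorem rotGraph_adj_iff {N : ℕ} (u v : RotSite d'' N) :
    (rotGraph d'' N).Adj u v ↔
      u ≠ v ∧ ((∃ i, v = u + rotProj d'' N (Pi.single i 1)) ∨ ∃ i, u = v + rotProj d'' N (Pi.single i 1)) := by
  simp only [rotGraph, SimpleGraph.circulantGraph_adj, Set.mem_range]
  refine and_congr_right fun _ => ?_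
  rw [or_comm]
  refine or_congr (exists_congr fun i => ?_) (exists_congr fun i => ?_)
  · rw [eq_sub_iff_add_eq', eq_comm]
  · rw [eq_sub_iff_add_eq', eq_comm]

/-- Adjacency on the rotated torus is decidable. [folklore] -/
instance {N : ℕ} : DecidableRel (rotGraph d'' N).Adj := fun u v =>
  decidable_of_iff _ (rotGraph_adj_iff u v).symm

/-- Translations are automorphisms of the rotated torus graph. [folklore] -/
theorem rotGraph_adj_add_right {N : ℕ} (w u v : RotSite d'' N) :
    (rotGraph d'' N).Adj (u + w) (v + w) ↔ (rotGraph d'' N).Adj u v := by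
  simp only [rotGraph_adj_iff, add_right_comm _ w, add_left_inj, ne_eq]

/-- A lattice vector with all coordinates of absolute value `< N` projects to `0` only if it is `0`
(the nonzero elements of `Γ_rot` have a coordinate of absolute value `≥ N`). [folklore] -/
theorem rotProj_eq_zero_iff_of_abs_lt {N : ℕ} {v : Site (d'' + 2)} (hv : ∀ j, |v j| < N) :
    rotProj d'' N v = 0 ↔ v = 0 := by
  constructor
  · intro h
    have h2 : ∀ j : Fin (d'' + 1), v j.succ = 0 := by
      intro j
      have hj : ((v j.succ : ℤ) : ZMod N) = 0 := by
        have := congrArg Prod.snd h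
        simpa [rotProj_apply_snd] using congrFun this j
      rw [ZMod.intCast_zmod_eq_zero_iff_dvd] at hj
      exact Int.eq_zero_of_abs_lt_dvd hj (hv j.succ)
    have h1 : v 1 = 0 := h2 0
    have h0 : v 0 = 0 := by
      have hj : ((v 0 + v 1 : ℤ) : ZMod (2 * N)) = 0 := by
        have := congrArg Prod.fst h
        simpa [rotProj_apply_fst] using this
      rw [h1, add_zero, ZMod.intCast_zmod_eq_zero_iff_dvd] at hj
      refine Int.eq_zero_of_abs_lt_dvd hj ?_
      have := hv 0
      push_cast
      omega
    funext j
    refine Fin.cases h0 (fun j => h2 j) j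
  · rintro rfl
    exact map_zero _

/-- `rotProj` is injective on a box of radius `M` with `2M < N`. [folklore] -/
theorem rotProj_injOn_box {M N : ℕ} (hMN : 2 * M < N) {x y : Site (d'' + 2)} (hx : x ∈ box (d'' + 2) M)
    (hy : y ∈ box (d'' + 2) M) (h : rotProj d'' N x = rotProj d'' N y) : x = y := by
  have h0 : rotProj d'' N (x - y) = 0 := by rw [map_sub, h, sub_self]
  have := (rotProj_eq_zero_iff_of_abs_lt (N := N) (v := x - y) fun j => ?_).1 h0
  · exact sub_eq_zero.1 this
  · rw [Pi.sub_apply]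
    exact lt_of_le_of_lt (abs_sub_le_of_mem_box hx hy j) (by exact_mod_cast hMN)

/-- Adjacency of images of box points is adjacency in `ℤ^{d''+2}` (`2M + 1 < N`). [folklore] -/
theorem rotGraph_adj_proj_iff {M N : ℕ} (hMN : 2 * M + 1 < N) {x y : Site (d'' + 2)}
    (hx : x ∈ box (d'' + 2) M) (hy : y ∈ box (d'' + 2) M) :
    (rotGraph d'' N).Adj (rotProj d'' N x) (rotProj d'' N y) ↔ (zdGraph (d'' + 2)).Adj x y := by
  have key : ∀ {x y : Site (d'' + 2)}, x ∈ box (d'' + 2) M → y ∈ box (d'' + 2) M → ∀ i : Fin (d'' + 2),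
      (rotProj d'' N y = rotProj d'' N x + rotProj d'' N (Pi.single i 1) ↔ y = x + Pi.single i 1) := by
    intro x y hx hy i
    have hbound : ∀ j, |(y - x - Pi.single i 1 : Site (d'' + 2)) j| < N := fun j => by
      have h1 := abs_sub_le_of_mem_box hy hx j
      have h2 : |(Pi.single i (1 : ℤ) : Site (d'' + 2)) j| ≤ 1 := by
        rcases eq_or_ne j i with rfl | hj
        · simp
        · simp [Pi.single_eq_of_ne hj]
      calc |(y - x - Pi.single i 1 : Site (d'' + 2)) j| = |(y j - x j) - (Pi.single i (1 : ℤ) : Site (d'' + 2)) j| := by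
            simp [Pi.sub_apply]
        _ ≤ |y j - x j| + |(Pi.single i (1 : ℤ) : Site (d'' + 2)) j| := abs_sub _ _
        _ < N := by
            have : (2 * M + 1 : ℤ) < N := by exact_mod_cast hMN
            linarith
    have hrew : rotProj d'' N y = rotProj d'' N x + rotProj d'' N (Pi.single i 1) ↔
        rotProj d'' N (y - x - Pi.single i 1) = 0 := by
      rw [map_sub, map_sub, sub_sub, sub_eq_zero]
    rw [hrew, rotProj_eq_zero_iff_of_abs_lt hbound, sub_sub, sub_eq_zero]
  rw [rotGraph_adj_iff, zdGraph_adj_iff]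
  constructor
  · rintro ⟨-, h | h⟩
    · obtain ⟨i, hi⟩ := h
      exact ⟨i, Or.inl ((key hx hy i).1 hi)⟩
    · obtain ⟨i, hi⟩ := h
      exact ⟨i, Or.inr ((key hy hx i).1 hi)⟩
  · rintro ⟨i, h | h⟩
    · refine ⟨fun hxy => ?_, Or.inl ⟨i, (key hx hy i).2 h⟩⟩
      have := rotProj_injOn_box (by omega) hx hy hxy
      subst this
      simpa using congrFun h i
    · refine ⟨fun hxy => ?_, Or.inr ⟨i, (key hy hx i).2 h⟩⟩
      have := rotProj_injOn_box (by omega) hx hy hxy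
      subst this
      simpa using congrFun h i

/-- The neighbours in the rotated torus of the image of `x ∈ ℤ^{d''+2}` are the images of its
lattice neighbours (any `N`). [folklore] -/
theorem rotGraph_adj_proj_left_iff (N : ℕ) (x : Site (d'' + 2)) (v : RotSite d'' N) :
    (rotGraph d'' N).Adj (rotProj d'' N x) v ↔
      rotProj d'' N x ≠ v ∧ ∃ y, rotProj d'' N y = v ∧ (zdGraph (d'' + 2)).Adj x y := by
  rw [rotGraph_adj_iff]
  refine and_congr_right fun hne => ?_
  constructor
  · rintro (⟨i, rfl⟩ | ⟨i, h⟩)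
    · exact ⟨x + Pi.single i 1, by rw [map_add], (zdGraph_adj_iff _ _).2 ⟨i, Or.inl rfl⟩⟩
    · refine ⟨x - Pi.single i 1, ?_, (zdGraph_adj_iff _ _).2 ⟨i, Or.inr (by simp)⟩⟩
      rw [map_sub, h, add_sub_cancel_right]
  · rintro ⟨y, rfl, hxy⟩
    obtain ⟨i, h | h⟩ := (zdGraph_adj_iff _ _).1 hxy
    · exact Or.inl ⟨i, by rw [h, map_add]⟩
    · exact Or.inr ⟨i, by rw [h, map_add]⟩

end Graph

/-! ### Part 2. The Ising model on the rotated torus: two-point function, Griffiths sandwich, limit -/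

section Ising

variable {d'' : ℕ} {N : ℕ} [NeZero N]

variable (d'' N) in
/-- The two-point function `⟨σ_uσ_v⟩^{rot}_{N;β}` of the periodic (free-on-the-whole-graph) Ising model
on the rotated torus. [cite: AizenmanDuminilCopinAnnals2021, arXiv:1912.07973 proof of Prop. 5.4 (iii) (p. 18)] -/
def rotTwoPoint (β : ℝ) (u v : RotSite d'' N) : ℝ :=
  isingTwoPoint (rotGraph d'' N) Finset.univ β 0 .free u v

/-- **Translation invariance**: `⟨σ_{u+w}σ_{v+w}⟩^{rot} = ⟨σ_uσ_v⟩^{rot}`. [cite: FriedliVelenik2017, §3.1] -/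
theorem rotTwoPoint_add_right (β : ℝ) (w u v : RotSite d'' N) :
    rotTwoPoint d'' N β (u + w) (v + w) = rotTwoPoint d'' N β u v := by
  have key := isingExpect_free_univ_comp (G := rotGraph d'' N) (Equiv.addRight w)
    (rotGraph_adj_add_right w) β 0 (measurable_spinPair (u + w) (v + w))
  have hobs : (fun σ : SpinConfig (RotSite d'' N) => spinPair (u + w) (v + w)
      (σ ∘ (Equiv.addRight w).symm)) = spinPair u v := by
    funext σ
    simp [spinPair, spinAt]
  rw [hobs] at key
  exact key.symm

/-- `⟨σ_uσ_v⟩^{rot} = ⟨σ₀σ_{v-u}⟩^{rot}`. [folklore] -/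
theorem rotTwoPoint_eq_zero_sub (β : ℝ) (u v : RotSite d'' N) :
    rotTwoPoint d'' N β u v = rotTwoPoint d'' N β 0 (v - u) := by
  have := rotTwoPoint_add_right β (-u) u v
  rw [add_neg_cancel, ← sub_eq_add_neg] at this
  exact this.symm

/-- `0 ≤ ⟨σ_uσ_v⟩^{rot}_β` for `β ≥ 0` (GKS I). [cite: FriedliVelenik2017, Thm. 3.20] -/
theorem rotTwoPoint_nonneg {β : ℝ} (hβ : 0 ≤ β) (u v : RotSite d'' N) : 0 ≤ rotTwoPoint d'' N β u v := by
  rcases eq_or_ne u v with rfl | huv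
  · simp [rotTwoPoint]
  · rw [rotTwoPoint, isingTwoPoint_eq_isingCorr _ _ _ _ _ huv]
    exact GriffithsKellySherman.gks_one_holds (rotGraph d'' N) hβ le_rfl (Or.inl rfl) (Finset.subset_univ _)

/-- `⟨σ_uσ_v⟩^{rot} ≤ 1`. [folklore] -/
theorem rotTwoPoint_le_one (β : ℝ) (u v : RotSite d'' N) : rotTwoPoint d'' N β u v ≤ 1 :=
  (le_abs_self _).trans (abs_isingTwoPoint_le_one _ _ _ _ _ _ _)

/-- **The free box inside the rotated torus is the free box**: for `x, y ∈ Λ_M`, `2M + 1 < N`, the image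
of `Λ_M` induces an isomorphic graph. [cite: FriedliVelenik2017, §3.1, Def. 3.1] -/
theorem isingTwoPoint_rot_image_box_eq {β : ℝ} (h : ℝ) {M : ℕ} (hMN : 2 * M + 1 < N) {x y : Site (d'' + 2)}
    (hx : x ∈ box (d'' + 2) M) (hy : y ∈ box (d'' + 2) M) :
    isingTwoPoint (rotGraph d'' N) ((box (d'' + 2) M).image (rotProj d'' N)) β h .free (rotProj d'' N x) (rotProj d'' N y) =
      isingTwoPoint (zdGraph (d'' + 2)) (box (d'' + 2) M) β h .free x y := by
  classical
  set S := ↥(box (d'' + 2) M) with hS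
  let ι₁ : S ↪ Site (d'' + 2) := Function.Embedding.subtype _
  let Gs : SimpleGraph S := (zdGraph (d'' + 2)).comap ι₁
  have h1 : isingTwoPoint (zdGraph (d'' + 2)) (box (d'' + 2) M) β h .free x y =
      isingTwoPoint Gs Finset.univ β h .free ⟨x, hx⟩ ⟨y, hy⟩ := by
    have hmap : (Finset.univ : Finset S).map ι₁ = box (d'' + 2) M := by
      rw [Finset.univ_eq_attach, Finset.attach_map_val]
    have := isingTwoPoint_free_map (G := Gs) (G' := zdGraph (d'' + 2)) ι₁ (Λ := Finset.univ)
      (fun a _ b _ => Iff.rfl) β h ⟨x, hx⟩ ⟨y, hy⟩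
    rw [hmap] at this
    exact this
  let ι₂ : S ↪ RotSite d'' N :=
    ⟨fun a => rotProj d'' N a.1, fun a b hab => Subtype.ext (rotProj_injOn_box (by omega) a.2 b.2 hab)⟩
  have hadj : ∀ a ∈ (Finset.univ : Finset S), ∀ b ∈ (Finset.univ : Finset S),
      ((rotGraph d'' N).Adj (ι₂ a) (ι₂ b) ↔ Gs.Adj a b) := fun a _ b _ => rotGraph_adj_proj_iff hMN a.2 b.2
  have hmap₂ : (Finset.univ : Finset S).map ι₂ = (box (d'' + 2) M).image (rotProj d'' N) := by
    ext u
    simp only [Finset.mem_map, Finset.mem_univ, true_and, Finset.mem_image]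
    constructor
    · rintro ⟨a, rfl⟩; exact ⟨a.1, a.2, rfl⟩
    · rintro ⟨z, hz, rfl⟩; exact ⟨⟨z, hz⟩, rfl⟩
  have h2 : isingTwoPoint Gs Finset.univ β h .free ⟨x, hx⟩ ⟨y, hy⟩ =
      isingTwoPoint (rotGraph d'' N) (Finset.univ.map ι₂) β h .free (rotProj d'' N x) (rotProj d'' N y) :=
    (isingTwoPoint_free_map (G := Gs) (G' := rotGraph d'' N) ι₂ hadj β h ⟨x, hx⟩ ⟨y, hy⟩).symm
  rw [h1, h2, hmap₂]

/-- **Free box ≤ rotated torus** (Griffiths II: enlarging the free volume from the image of the box to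
the whole rotated torus, `isingCorr_free_le_of_subset`). [cite: FriedliVelenik2017, Exercise 3.12, p. 112] -/
theorem isingTwoPoint_free_box_le_rotTwoPoint {β : ℝ} (hβ : 0 ≤ β) {M : ℕ} (hMN : 2 * M + 1 < N)
    {x y : Site (d'' + 2)} (hx : x ∈ box (d'' + 2) M) (hy : y ∈ box (d'' + 2) M) :
    isingTwoPoint (zdGraph (d'' + 2)) (box (d'' + 2) M) β 0 .free x y ≤
      rotTwoPoint d'' N β (rotProj d'' N x) (rotProj d'' N y) := by
  classical
  rcases eq_or_ne x y with rfl | hxy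
  · simp [rotTwoPoint]
  have hne : rotProj d'' N x ≠ rotProj d'' N y := fun h => hxy (rotProj_injOn_box (by omega) hx hy h)
  rw [← isingTwoPoint_rot_image_box_eq 0 hMN hx hy, rotTwoPoint, isingTwoPoint_eq_isingCorr _ _ _ _ _ hne,
    isingTwoPoint_eq_isingCorr _ _ _ _ _ hne]
  refine isingCorr_free_le_of_subset (rotGraph d'' N) hβ le_rfl ?_ (Finset.subset_univ _)
  intro z hz
  simp only [Finset.mem_insert, Finset.mem_singleton] at hz
  rcases hz with rfl | rfl
  · exact Finset.mem_image.2 ⟨x, hx, rfl⟩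
  · exact Finset.mem_image.2 ⟨y, hy, rfl⟩

/-- **Rotated torus ≤ plus box** (freezing to `+1` the spins outside the image of `Λ_M` raises
correlations, `isingCorr_plus_le_of_subset`; the frozen model is the `+` box transported along the
embedding of `Λ_{M+1}`, `isingCorr_plus_map` of `TorusZeroMode`, twice). For `β ≥ 0`, `A ⊆ Λ_M` and
`2M + 4 ≤ N`. [cite: FriedliVelenik2017, Exercise 3.12, p. 112] -/
theorem isingCorr_rot_le_isingCorr_plus_box {β : ℝ} (hβ : 0 ≤ β) {M : ℕ} (hMN : 2 * M + 4 ≤ N)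
    {A : Finset (Site (d'' + 2))} (hA : A ⊆ box (d'' + 2) M) :
    isingCorr (rotGraph d'' N) Finset.univ β 0 .free (A.image (rotProj d'' N)) ≤
      isingCorr (zdGraph (d'' + 2)) (box (d'' + 2) M) β 0 .plus A := by
  classical
  set S := ↥(box (d'' + 2) (M + 1)) with hS
  let ι₁ : S ↪ Site (d'' + 2) := Function.Embedding.subtype _
  let Gs : SimpleGraph S := (zdGraph (d'' + 2)).comap ι₁
  let ι₂ : S ↪ RotSite d'' N :=
    ⟨fun a => rotProj d'' N a.1, fun a b hab => Subtype.ext (rotProj_injOn_box (by omega) a.2 b.2 hab)⟩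
  have hMM : box (d'' + 2) M ⊆ box (d'' + 2) (M + 1) := box_mono (d'' + 2) (Nat.le_succ M)
  set Λ₀ : Finset S := Finset.univ.filter fun a => (a : Site (d'' + 2)) ∈ box (d'' + 2) M with hΛ₀
  set A₀ : Finset S := Finset.univ.filter fun a => (a : Site (d'' + 2)) ∈ A with hA₀
  have hΛ₀map : Λ₀.map ι₁ = box (d'' + 2) M := by
    ext x
    simp only [Finset.mem_map, Finset.mem_filter, Finset.mem_univ, true_and, hΛ₀]
    constructor
    · rintro ⟨a, ha, rfl⟩; exact ha
    · intro hx; exact ⟨⟨x, hMM hx⟩, hx, rfl⟩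
  have hA₀map : A₀.map ι₁ = A := by
    ext x
    simp only [Finset.mem_map, Finset.mem_filter, Finset.mem_univ, true_and, hA₀]
    constructor
    · rintro ⟨a, ha, rfl⟩; exact ha
    · intro hx; exact ⟨⟨x, hMM (hA hx)⟩, hx, rfl⟩
  have hA₀map₂ : A₀.map ι₂ = A.image (rotProj d'' N) := by
    ext x'
    simp only [Finset.mem_map, Finset.mem_filter, Finset.mem_univ, true_and, hA₀, Finset.mem_image]
    constructor
    · rintro ⟨a, ha, rfl⟩; exact ⟨a, ha, rfl⟩
    · rintro ⟨x, hx, rfl⟩; exact ⟨⟨x, hMM (hA hx)⟩, hx, rfl⟩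
  have hA₀Λ₀ : A₀ ⊆ Λ₀ := by
    intro a ha
    simp only [Finset.mem_filter, Finset.mem_univ, true_and, hA₀, hΛ₀] at ha ⊢
    exact hA ha
  have hadj₁ : ∀ a ∈ Λ₀, ∀ b : S, (zdGraph (d'' + 2)).Adj (ι₁ a) (ι₁ b) ↔ Gs.Adj a b := fun a _ b => Iff.rfl
  have hnb₁ : ∀ a ∈ Λ₀, ∀ y : Site (d'' + 2), (zdGraph (d'' + 2)).Adj (ι₁ a) y → ∃ b : S, ι₁ b = y := by
    intro a ha y h
    have ha' : (a : Site (d'' + 2)) ∈ box (d'' + 2) M := by simpa [hΛ₀] using ha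
    exact ⟨⟨y, mem_box_succ_of_zdGraph_adj (d := d'' + 2) ha' h⟩, rfl⟩
  have hadj₂ : ∀ a ∈ Λ₀, ∀ b : S, (rotGraph d'' N).Adj (ι₂ a) (ι₂ b) ↔ Gs.Adj a b := by
    intro a _ b
    exact rotGraph_adj_proj_iff (M := M + 1) (by omega) a.2 b.2
  have hnb₂ : ∀ a ∈ Λ₀, ∀ v : RotSite d'' N, (rotGraph d'' N).Adj (ι₂ a) v → ∃ b : S, ι₂ b = v := by
    intro a ha v h
    have ha' : (a : Site (d'' + 2)) ∈ box (d'' + 2) M := by simpa [hΛ₀] using ha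
    obtain ⟨-, y, rfl, hy⟩ := (rotGraph_adj_proj_left_iff N a.1 v).1 h
    exact ⟨⟨y, mem_box_succ_of_zdGraph_adj (d := d'' + 2) ha' hy⟩, rfl⟩
  have hΛimg : Λ₀.map ι₂ ⊆ (Finset.univ : Finset (RotSite d'' N)) := Finset.subset_univ _
  have hAimg : A₀.map ι₂ ⊆ Λ₀.map ι₂ := Finset.map_subset_map.2 hA₀Λ₀
  calc isingCorr (rotGraph d'' N) Finset.univ β 0 .free (A.image (rotProj d'' N))
      = isingCorr (rotGraph d'' N) Finset.univ β 0 .plus (A₀.map ι₂) := by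
        rw [← hA₀map₂, isingCorr_univ_plus_eq_free]
    _ ≤ isingCorr (rotGraph d'' N) (Λ₀.map ι₂) β 0 .plus (A₀.map ι₂) :=
        isingCorr_plus_le_of_subset (rotGraph d'' N) hβ le_rfl hAimg hΛimg
    _ = isingCorr Gs Λ₀ β 0 .plus A₀ := isingCorr_plus_map ι₂ hadj₂ hnb₂ β 0 A₀
    _ = isingCorr (zdGraph (d'' + 2)) (Λ₀.map ι₁) β 0 .plus (A₀.map ι₁) := (isingCorr_plus_map ι₁ hadj₁ hnb₁ β 0 A₀).symm
    _ = isingCorr (zdGraph (d'' + 2)) (box (d'' + 2) M) β 0 .plus A := by rw [hΛ₀map, hA₀map]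

/-- **Rotated torus ≤ plus box for the two-point function** (`x ≠ y` in `Λ_M`, `2M + 4 ≤ N`). [cite: FriedliVelenik2017, Exercise 3.12, p. 112] -/
theorem rotTwoPoint_le_isingCorr_plus_box {β : ℝ} (hβ : 0 ≤ β) {M : ℕ} (hMN : 2 * M + 4 ≤ N)
    {x y : Site (d'' + 2)} (hx : x ∈ box (d'' + 2) M) (hy : y ∈ box (d'' + 2) M) (hxy : x ≠ y) :
    rotTwoPoint d'' N β (rotProj d'' N x) (rotProj d'' N y) ≤ isingCorr (zdGraph (d'' + 2)) (box (d'' + 2) M) β 0 .plus {x, y} := by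
  classical
  have hne : rotProj d'' N x ≠ rotProj d'' N y := fun h => hxy (rotProj_injOn_box (by omega) hx hy h)
  have himg : ({x, y} : Finset (Site (d'' + 2))).image (rotProj d'' N) = {rotProj d'' N x, rotProj d'' N y} := by
    simp [Finset.image_insert, Finset.image_singleton]
  have key := isingCorr_rot_le_isingCorr_plus_box (d'' := d'') (N := N) hβ hMN
    (A := {x, y}) (Finset.insert_subset hx (Finset.singleton_subset_iff.2 hy))
  rw [himg] at key
  rw [rotTwoPoint, isingTwoPoint_eq_isingCorr _ _ _ _ _ hne]
  exact key

/-- **The rotated-torus two-point function converges to the infinite-volume one** (the analogue of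
Aizenman–Duminil-Copin 2021, Prop. 5.2 for these volumes: "for `β < β_c(ρ)` the change does not
affect the two-point function's infinite volume limit", proof of Prop. 5.4): for `β ≥ 0`, `x ≠ y`,
and `⟨σ_xσ_y⟩^∅_β = ⟨σ_xσ_y⟩⁺_β`, `|⟨σ_{x̄}σ_{ȳ}⟩^{rot}_{N;β} - ⟨σ_xσ_y⟩⁺_β| ≤ ε` for all `N ≥ N₀`.
[cite: AizenmanDuminilCopinAnnals2021, arXiv:1912.07973 Prop. 5.2 and proof of Prop. 5.4 (iii) (p. 17–18)] -/
theorem abs_rotTwoPoint_sub_plusCorr_le {β : ℝ} (hβ : 0 ≤ β) {x y : Site (d'' + 2)} (hxy : x ≠ y)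
    (heq : freeCorr (d'' + 2) β 0 {x, y} = plusCorr (d'' + 2) β 0 {x, y}) {ε : ℝ} (hε : 0 < ε) :
    ∃ N₀ : ℕ, ∀ N : ℕ, N₀ ≤ N → ∀ [NeZero N],
      |rotTwoPoint d'' N β (rotProj d'' N x) (rotProj d'' N y) - plusCorr (d'' + 2) β 0 {x, y}| ≤ ε := by
  classical
  obtain ⟨L₀, hL₀⟩ := exists_forall_subset_box (d'' + 2) ({x, y} : Finset (Site (d'' + 2)))
  have hxy₀ : ∀ n, L₀ ≤ n → x ∈ box (d'' + 2) n ∧ y ∈ box (d'' + 2) n := fun n hn =>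
    ⟨hL₀ n hn (by simp), hL₀ n hn (by simp)⟩
  have hfree := hasBoxLimit_isingCorr_free_holds (d := d'' + 2) hβ le_rfl ({x, y} : Finset (Site (d'' + 2)))
  have hplus := hasBoxLimit_isingCorr_plus_holds (d := d'' + 2) hβ le_rfl ({x, y} : Finset (Site (d'' + 2)))
  rw [HasBoxLimit, Metric.tendsto_atTop] at hfree hplus
  obtain ⟨n₁, hn₁⟩ := hfree ε hε
  obtain ⟨n₂, hn₂⟩ := hplus ε hε
  set n := max L₀ (max n₁ n₂) with hn
  obtain ⟨hxn, hyn⟩ := hxy₀ n (le_max_left _ _)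
  refine ⟨2 * n + 4, fun N hN _ => ?_⟩
  have hlow := isingTwoPoint_free_box_le_rotTwoPoint (d'' := d'') (N := N) hβ (by omega) hxn hyn
  have hup := rotTwoPoint_le_isingCorr_plus_box (d'' := d'') (N := N) hβ (by omega) hxn hyn hxy
  have hfreepair : isingTwoPoint (zdGraph (d'' + 2)) (box (d'' + 2) n) β 0 .free x y =
      isingCorr (zdGraph (d'' + 2)) (box (d'' + 2) n) β 0 .free {x, y} := isingTwoPoint_eq_isingCorr _ _ _ _ _ hxy
  have h1 := hn₁ n (le_trans (le_max_left _ _) (le_max_right _ _))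
  have h2 := hn₂ n (le_trans (le_max_right _ _) (le_max_right _ _))
  rw [Real.dist_eq] at h1 h2
  rw [abs_le]
  constructor
  · have := (abs_lt.1 h1).1
    rw [heq] at this
    linarith [hfreepair ▸ hlow]
  · have := (abs_lt.1 h2).2
    linarith

end Ising

/-! ### Part 3. The quotient sup-norm and the uniform exponential decay on the rotated torus -/

section Decay

variable {d'' : ℕ} {N : ℕ} [NeZero N]

/-- Every site of the rotated torus is the image of a lattice point. [folklore] -/
theorem rotProj_surjective : Function.Surjective (rotProj d'' N) := by
  intro u
  refine ⟨Fin.cons ((u.1.val : ℤ) - (u.2 0).val) (fun j => ((u.2 j).val : ℤ)), ?_⟩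
  ext j
  · rw [rotProj_apply_fst]
    simp
  · rw [rotProj_apply_snd]
    simp

open scoped Classical in
/-- The **quotient sup-norm** on the rotated torus: the least sup-norm of a representative,
`|u|_rot = min {‖x‖_∞ : x̄ = u}`. [folklore] -/
def rotNorm (u : RotSite d'' N) : ℕ :=
  Nat.find (p := fun n => ∃ x : Site (d'' + 2), rotProj d'' N x = u ∧ Site.supNorm x ≤ n)
    (Exists.elim (rotProj_surjective u) fun x hx => ⟨Site.supNorm x, x, hx, le_rfl⟩)

/-- A representative realising the quotient norm (up to `≤`). [folklore] -/
theorem exists_rep_rotNorm (u : RotSite d'' N) : ∃ x : Site (d'' + 2), rotProj d'' N x = u ∧ Site.supNorm x ≤ rotNorm u := by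
  classical
  exact Nat.find_spec (p := fun n => ∃ x : Site (d'' + 2), rotProj d'' N x = u ∧ Site.supNorm x ≤ n)
    (Exists.elim (rotProj_surjective u) fun x hx => ⟨Site.supNorm x, x, hx, le_rfl⟩)

/-- `|x̄|_rot ≤ ‖x‖_∞`. [folklore] -/
theorem rotNorm_proj_le (x : Site (d'' + 2)) : rotNorm (rotProj d'' N x) ≤ Site.supNorm x := by
  classical
  exact Nat.find_le ⟨x, rfl, le_rfl⟩

/-- The quotient norm is the least sup-norm of a representative. [folklore] -/
theorem rotNorm_le_iff (u : RotSite d'' N) (n : ℕ) : rotNorm u ≤ n ↔ ∃ x : Site (d'' + 2), rotProj d'' N x = u ∧ Site.supNorm x ≤ n := by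
  constructor
  · intro h
    obtain ⟨x, hx, hle⟩ := exists_rep_rotNorm u
    exact ⟨x, hx, hle.trans h⟩
  · rintro ⟨x, hx, hle⟩
    exact (hx ▸ rotNorm_proj_le x).trans hle

/-- **Triangle inequality** for the quotient norm. [folklore] -/
theorem rotNorm_add_le (u v : RotSite d'' N) : rotNorm (u + v) ≤ rotNorm u + rotNorm v := by
  obtain ⟨x, hx, hxle⟩ := exists_rep_rotNorm u
  obtain ⟨y, hy, hyle⟩ := exists_rep_rotNorm v
  rw [rotNorm_le_iff]
  exact ⟨x + y, by rw [map_add, hx, hy], (Site.supNorm_add_le x y).trans (Nat.add_le_add hxle hyle)⟩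

/-- `|u|_rot ≤ |u - v|_rot + |v|_rot`. [folklore] -/
theorem rotNorm_le_rotNorm_sub_add (u v : RotSite d'' N) : rotNorm u ≤ rotNorm (u - v) + rotNorm v := by
  have := rotNorm_add_le (u - v) v
  rwa [sub_add_cancel] at this

/-- Points of the image of `Λ_R` have quotient norm `≤ R`. [folklore] -/
theorem rotNorm_le_of_mem_image_box {R : ℕ} {u : RotSite d'' N} (hu : u ∈ (box (d'' + 2) R).image (rotProj d'' N)) :
    rotNorm u ≤ R := by
  obtain ⟨y, hy, rfl⟩ := Finset.mem_image.1 hu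
  refine (rotNorm_proj_le y).trans ?_
  rw [mem_box] at hy
  unfold Site.supNorm
  refine Finset.sup_le fun i _ => ?_
  have := hy i
  omega

/-- **The modified Simon inequality on the rotated torus** (Duminil-Copin–Tassion 2016, Lemma 2.7 on
the finite graph `ℤ^{d''+2}/Γ_rot`, `isingTwoPoint_free_le_modifiedSimon`, with `S` the image of
`Λ_R`, an isomorphic copy of the free box for `2R + 4 ≤ N`): for `β ≥ 0` and `|u|_rot > R`,
`⟨σ₀σ_u⟩^{rot} ≤ ∑_{x ∈ Λ_R} ∑_{y ∼ x, y ∉ Λ_R} tanh β ⟨σ₀σ_x⟩^∅_{Λ_R} ⟨σ₀σ_{u-ȳ}⟩^{rot}`.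
[cite: DuminilCopinTassionCMP2016, Lemma 2.7 (modified Simon inequality), §2.5 (arXiv:1502.03050 numbering)] -/
theorem rotTwoPoint_le_modifiedSimon {β : ℝ} (hβ : 0 ≤ β) {R : ℕ} (hRN : 2 * R + 4 ≤ N)
    {u : RotSite d'' N} (hu : R < rotNorm u) :
    rotTwoPoint d'' N β 0 u ≤
      ∑ x ∈ box (d'' + 2) R, ∑ y ∈ ((zdGraph (d'' + 2)).neighborFinset x).filter (fun y => y ∉ box (d'' + 2) R),
        Real.tanh β * isingTwoPoint (zdGraph (d'' + 2)) (box (d'' + 2) R) β 0 .free 0 x *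
          rotTwoPoint d'' N β 0 (u - rotProj d'' N y) := by
  classical
  set S : Finset (RotSite d'' N) := (box (d'' + 2) R).image (rotProj d'' N) with hS
  have h0S : (0 : RotSite d'' N) ∈ S := Finset.mem_image.2 ⟨0, by simp [mem_box], map_zero _⟩
  have huS : u ∉ S := fun huS => absurd (rotNorm_le_of_mem_image_box huS) (not_le.2 hu)
  have key := isingTwoPoint_free_le_modifiedSimon (rotGraph d'' N) hβ (Finset.subset_univ S) h0S
    (Finset.mem_univ u) huS
  rw [rotTwoPoint]
  refine key.trans (le_of_eq ?_)
  have hinjR : Set.InjOn (rotProj d'' N) (box (d'' + 2) R : Set (Site (d'' + 2))) := fun a ha b hb hab =>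
    rotProj_injOn_box (by omega) ha hb hab
  rw [hS, Finset.sum_image hinjR]
  refine Finset.sum_congr rfl fun x hx => ?_
  have hinj1 : Set.InjOn (rotProj d'' N) (((zdGraph (d'' + 2)).neighborFinset x).filter (fun y => y ∉ box (d'' + 2) R) : Set (Site (d'' + 2))) := by
    intro a ha b hb hab
    have ha' : a ∈ box (d'' + 2) (R + 1) := mem_box_succ_of_zdGraph_adj (d := d'' + 2) hx (by simpa using (Finset.mem_filter.1 ha).1)
    have hb' : b ∈ box (d'' + 2) (R + 1) := mem_box_succ_of_zdGraph_adj (d := d'' + 2) hx (by simpa using (Finset.mem_filter.1 hb).1)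
    exact rotProj_injOn_box (by omega) ha' hb' hab
  have hset : (Finset.univ \ (box (d'' + 2) R).image (rotProj d'' N)).filter ((rotGraph d'' N).Adj (rotProj d'' N x)) =
      (((zdGraph (d'' + 2)).neighborFinset x).filter (fun y => y ∉ box (d'' + 2) R)).image (rotProj d'' N) := by
    ext w
    simp only [Finset.mem_filter, Finset.mem_sdiff, Finset.mem_univ, true_and, Finset.mem_image,
      SimpleGraph.mem_neighborFinset]
    constructor
    · rintro ⟨hw, hadj⟩
      obtain ⟨-, y, rfl, hxy⟩ := (rotGraph_adj_proj_left_iff N x w).1 hadj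
      refine ⟨y, ⟨hxy, fun hyR => hw ⟨y, hyR, rfl⟩⟩, rfl⟩
    · rintro ⟨y, ⟨hxy, hyR⟩, rfl⟩
      have hy' : y ∈ box (d'' + 2) (R + 1) := mem_box_succ_of_zdGraph_adj (d := d'' + 2) hx hxy
      refine ⟨?_, ?_⟩
      · rintro ⟨y₀, hy₀, heq⟩
        have := rotProj_injOn_box (M := R + 1) (by omega) (box_mono (d'' + 2) (Nat.le_succ R) hy₀) hy' heq
        subst this
        exact hyR hy₀
      · exact (rotGraph_adj_proj_iff (M := R + 1) (by omega) (box_mono (d'' + 2) (Nat.le_succ R) hx) hy').2 hxy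
  rw [hset, Finset.sum_image hinj1]
  refine Finset.sum_congr rfl fun y _ => ?_
  have h0 : (0 : Site (d'' + 2)) ∈ box (d'' + 2) R := by simp [mem_box]
  rw [show (0 : RotSite d'' N) = rotProj d'' N 0 from (map_zero _).symm,
    isingTwoPoint_rot_image_box_eq 0 (by omega) h0 hx]
  congr 1
  rw [map_zero, ← rotTwoPoint, rotTwoPoint_eq_zero_sub]

/-- **The iteration on the rotated torus** (DCT 2016, §2.5): for `β ≥ 0`, `2R + 4 ≤ N`, every `k` and
every `u` with `k(R+1) ≤ |u|_rot`, `⟨σ₀σ_u⟩^{rot}_{N;β} ≤ φ_β(Λ_R)^k`. [cite: DuminilCopinTassionCMP2016, §2.5, end of the proof of Thm. 2.1 (iteration)] -/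
theorem rotTwoPoint_le_dctIsingPhi_pow_of_le {β : ℝ} (hβ : 0 ≤ β) {R : ℕ} (hRN : 2 * R + 4 ≤ N) :
    ∀ (k : ℕ) (u : RotSite d'' N), k * (R + 1) ≤ rotNorm u →
      rotTwoPoint d'' N β 0 u ≤ dctIsingPhi (d'' + 2) β (box (d'' + 2) R) ^ k := by
  intro k
  induction k with
  | zero =>
    intro u _
    rw [pow_zero]
    exact rotTwoPoint_le_one β 0 u
  | succ k ih =>
    intro u hu
    have hR : R < rotNorm u := by
      have : (k + 1) * (R + 1) = k * (R + 1) + (R + 1) := by ring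
      omega
    refine (rotTwoPoint_le_modifiedSimon hβ hRN hR).trans ?_
    have h0 : (0 : Site (d'' + 2)) ∈ box (d'' + 2) R := by simp [mem_box]
    have hbound : ∀ x ∈ box (d'' + 2) R, ∀ y ∈ ((zdGraph (d'' + 2)).neighborFinset x).filter (fun y => y ∉ box (d'' + 2) R),
        Real.tanh β * isingTwoPoint (zdGraph (d'' + 2)) (box (d'' + 2) R) β 0 .free 0 x *
            rotTwoPoint d'' N β 0 (u - rotProj d'' N y) ≤
          Real.tanh β * isingTwoPoint (zdGraph (d'' + 2)) (box (d'' + 2) R) β 0 .free 0 x *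
            dctIsingPhi (d'' + 2) β (box (d'' + 2) R) ^ k := by
      intro x hx y hy
      refine mul_le_mul_of_nonneg_left ?_
        (mul_nonneg (tanh_nonneg hβ) (isingTwoPoint_free_nonneg
          (fun {_ _ _ _ _} => GriffithsKellySherman.gks_one_holds (zdGraph (d'' + 2))) hβ h0 hx))
      refine ih (u - rotProj d'' N y) ?_
      have hyx : (zdGraph (d'' + 2)).Adj x y := by simpa using (Finset.mem_filter.1 hy).1
      have hy1 : Site.supNorm y ≤ R + 1 := by
        have := mem_box_succ_of_zdGraph_adj (d := d'' + 2) hx hyx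
        rw [mem_box] at this
        unfold Site.supNorm
        refine Finset.sup_le fun i _ => ?_
        have := this i
        omega
      have htri := rotNorm_le_rotNorm_sub_add u (rotProj d'' N y)
      have hproj : rotNorm (rotProj d'' N y) ≤ R + 1 := (rotNorm_proj_le y).trans hy1
      have : (k + 1) * (R + 1) = k * (R + 1) + (R + 1) := by ring
      omega
    calc ∑ x ∈ box (d'' + 2) R, ∑ y ∈ ((zdGraph (d'' + 2)).neighborFinset x).filter (fun y => y ∉ box (d'' + 2) R),
          Real.tanh β * isingTwoPoint (zdGraph (d'' + 2)) (box (d'' + 2) R) β 0 .free 0 x *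
            rotTwoPoint d'' N β 0 (u - rotProj d'' N y)
        ≤ ∑ x ∈ box (d'' + 2) R, ∑ y ∈ ((zdGraph (d'' + 2)).neighborFinset x).filter (fun y => y ∉ box (d'' + 2) R),
          Real.tanh β * isingTwoPoint (zdGraph (d'' + 2)) (box (d'' + 2) R) β 0 .free 0 x *
            dctIsingPhi (d'' + 2) β (box (d'' + 2) R) ^ k :=
          Finset.sum_le_sum fun x hx => Finset.sum_le_sum fun y hy => hbound x hx y hy
      _ = (∑ x ∈ box (d'' + 2) R, ∑ _y ∈ ((zdGraph (d'' + 2)).neighborFinset x).filter (fun y => y ∉ box (d'' + 2) R),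
            Real.tanh β * isingTwoPoint (zdGraph (d'' + 2)) (box (d'' + 2) R) β 0 .free 0 x) *
              dctIsingPhi (d'' + 2) β (box (d'' + 2) R) ^ k := by
          simp_rw [Finset.sum_mul]
      _ = dctIsingPhi (d'' + 2) β (box (d'' + 2) R) ^ (k + 1) := by
          rw [pow_succ', dctIsingPhi_def]

/-- **Uniform decay on the rotated torus**: for `β ≥ 0` and `2R + 4 ≤ N`,
`⟨σ₀σ_u⟩^{rot}_{N;β} ≤ φ_β(Λ_R)^{⌊|u|_rot/(R+1)⌋}` — uniformly in `N`. [cite: DuminilCopinTassionCMP2016, Thm. 2.1 (3) with Lemma 2.7, §2.5] -/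
theorem rotTwoPoint_le_dctIsingPhi_pow {β : ℝ} (hβ : 0 ≤ β) {R : ℕ} (hRN : 2 * R + 4 ≤ N) (u : RotSite d'' N) :
    rotTwoPoint d'' N β 0 u ≤ dctIsingPhi (d'' + 2) β (box (d'' + 2) R) ^ (rotNorm u / (R + 1)) :=
  rotTwoPoint_le_dctIsingPhi_pow_of_le hβ hRN _ u (Nat.div_mul_le_self _ _)

omit [NeZero N] in
/-- **Structure of the kernel `Γ_rot`**: if `γ̄ = 0`, `γ ≠ 0`, and `x` lies in the representative domain
(`|x₀| ≤ N`, `2|x_j| ≤ N` for `j ≥ 1`), then `x + γ` has a coordinate of absolute value `≥ N/2`: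
either some `γ_j`, `j ≥ 1`, is a nonzero multiple of `N`, or `γ = (γ₀, 0, …)` with `γ₀` a nonzero
multiple of `2N`. [folklore] -/
theorem exists_two_mul_abs_add_ge {γ x : Site (d'' + 2)} (hγ : rotProj d'' N γ = 0) (hγ0 : γ ≠ 0)
    (hx0 : |x 0| ≤ N) (hx : ∀ j : Fin (d'' + 1), 2 * |x j.succ| ≤ N) :
    ∃ j, (N : ℤ) ≤ 2 * |(x + γ) j| := by
  have hdiv : ∀ j : Fin (d'' + 1), (N : ℤ) ∣ γ j.succ := fun j => by
    have : ((γ j.succ : ℤ) : ZMod N) = 0 := by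
      have := congrArg Prod.snd hγ
      simpa [rotProj_apply_snd] using congrFun this j
    exact (ZMod.intCast_zmod_eq_zero_iff_dvd _ _).1 this
  by_cases hrest : ∃ j : Fin (d'' + 1), γ j.succ ≠ 0
  · obtain ⟨j, hj⟩ := hrest
    refine ⟨j.succ, ?_⟩
    have hN : (N : ℤ) ≤ |γ j.succ| := by
      obtain ⟨c, hc⟩ := hdiv j
      have hc0 : c ≠ 0 := by rintro rfl; exact hj (by simpa using hc)
      rw [hc, abs_mul]
      have : (1 : ℤ) ≤ |c| := Int.one_le_abs hc0
      have hNn : (0 : ℤ) ≤ |(N : ℤ)| := abs_nonneg _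
      calc (N : ℤ) ≤ |(N : ℤ)| := le_abs_self _
        _ = |(N : ℤ)| * 1 := (mul_one _).symm
        _ ≤ |(N : ℤ)| * |c| := mul_le_mul_of_nonneg_left this hNn
    have htri : |γ j.succ| ≤ |(x + γ) j.succ| + |x j.succ| := by
      have := abs_sub ((x + γ) j.succ) (x j.succ)
      simpa using this
    have := hx j
    linarith
  · push Not at hrest
    refine ⟨0, ?_⟩
    have h1 : γ 1 = 0 := hrest 0
    have h0div : (2 * N : ℤ) ∣ γ 0 := by
      have : ((γ 0 + γ 1 : ℤ) : ZMod (2 * N)) = 0 := by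
        have := congrArg Prod.fst hγ
        simpa [rotProj_apply_fst] using this
      rw [h1, add_zero, ZMod.intCast_zmod_eq_zero_iff_dvd] at this
      exact_mod_cast this
    have hγ00 : γ 0 ≠ 0 := by
      intro h0
      apply hγ0
      funext j
      refine Fin.cases h0 (fun j => hrest j) j
    obtain ⟨c, hc⟩ := h0div
    have hc0 : c ≠ 0 := by rintro rfl; exact hγ00 (by simpa using hc)
    have h2N : (2 * N : ℤ) ≤ |γ 0| := by
      rw [hc, abs_mul]
      have : (1 : ℤ) ≤ |c| := Int.one_le_abs hc0
      have hNn : (0 : ℤ) ≤ |(2 * N : ℤ)| := abs_nonneg _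
      calc (2 * N : ℤ) ≤ |(2 * N : ℤ)| := le_abs_self _
        _ = |(2 * N : ℤ)| * 1 := (mul_one _).symm
        _ ≤ |(2 * N : ℤ)| * |c| := mul_le_mul_of_nonneg_left this hNn
    have htri : |γ 0| ≤ |(x + γ) 0| + |x 0| := by
      have := abs_sub ((x + γ) 0) (x 0)
      simpa using this
    have : (0 : ℤ) ≤ |(x + γ) 0| := abs_nonneg _
    linarith

/-- **The quotient norm on the representative domain**: if `|x₀| ≤ N` and `2|x_j| ≤ N` for `j ≥ 1`
then `‖x‖_∞ ≤ 2|x̄|_rot` (any other representative has sup-norm `≥ N/2`, and `‖x‖_∞ ≤ N`). [folklore] -/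
theorem supNorm_le_two_mul_rotNorm {x : Site (d'' + 2)} (hx0 : |x 0| ≤ N) (hx : ∀ j : Fin (d'' + 1), 2 * |x j.succ| ≤ N) :
    Site.supNorm x ≤ 2 * rotNorm (rotProj d'' N x) := by
  obtain ⟨y, hy, hyle⟩ := exists_rep_rotNorm (rotProj d'' N x)
  have hγ : rotProj d'' N (y - x) = 0 := by rw [map_sub, hy, sub_self]
  have hsupx : Site.supNorm x ≤ N := by
    unfold Site.supNorm
    refine Finset.sup_le fun j _ => ?_
    have : ((x j).natAbs : ℤ) ≤ N := by
      rw [Int.natCast_natAbs]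
      refine Fin.cases ?_ (fun j => ?_) j
      · exact hx0
      · have := hx j; linarith [abs_nonneg (x j.succ)]
    exact_mod_cast this
  rcases eq_or_ne (y - x) 0 with h0 | h0
  · have : y = x := sub_eq_zero.1 h0
    subst this
    omega
  · obtain ⟨j, hj⟩ := exists_two_mul_abs_add_ge hγ h0 hx0 hx
    rw [add_sub_cancel] at hj
    have hyj : ((y j).natAbs : ℤ) ≤ Site.supNorm y := by exact_mod_cast Site.natAbs_le_supNorm y j
    rw [Int.natCast_natAbs] at hyj
    have : (Site.supNorm x : ℤ) ≤ 2 * Site.supNorm y := by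
      have : (Site.supNorm x : ℤ) ≤ N := by exact_mod_cast hsupx
      linarith
    have : Site.supNorm x ≤ 2 * Site.supNorm y := by exact_mod_cast this
    omega

/-- **Uniform exponential decay on the rotated tori below `β_c`**, packaged on the representative
domain: for `0 ≤ β < β_c(d''+2)` there are `R ≥ 1`, `θ ∈ [0,1)` with
`0 ≤ ⟨σ₀σ_{x̄}⟩^{rot}_{N;β} ≤ θ^{⌊‖x‖_∞/(4(R+1))⌋}` whenever `N ≥ 2R + 4`, `|x₀| ≤ N` and `2|x_j| ≤ N`
(`j ≥ 1`). [cite: DuminilCopinTassionCMP2016, Thm. 2.1 (3), Lemma 2.7, §2.5] [cite: AizenmanDuminilCopinAnnals2021, arXiv:1912.07973 Prop. 5.2 (p. 17)] -/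
theorem exists_uniform_decay_rotTwoPoint {β : ℝ} (hβ : 0 ≤ β) (hβc : β < criticalBeta (d'' + 2)) :
    ∃ (R : ℕ) (θ : ℝ), 1 ≤ R ∧ 0 ≤ θ ∧ θ < 1 ∧
      ∀ (N : ℕ) [NeZero N], 2 * R + 4 ≤ N → ∀ x : Site (d'' + 2), |x 0| ≤ N →
        (∀ j : Fin (d'' + 1), 2 * |x j.succ| ≤ N) →
        0 ≤ rotTwoPoint d'' N β 0 (rotProj d'' N x) ∧
          rotTwoPoint d'' N β 0 (rotProj d'' N x) ≤ θ ^ (Site.supNorm x / (4 * (R + 1))) := by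
  obtain ⟨R, hR1, hφ⟩ := exists_dctIsingPhi_box_lt_one_of_lt_criticalBeta (d := d'' + 2) (by omega) hβ hβc
  have hφ0 : 0 ≤ dctIsingPhi (d'' + 2) β (box (d'' + 2) R) :=
    dctIsingPhi_nonneg (fun {_ _ _ _ _} => GriffithsKellySherman.gks_one_holds (zdGraph (d'' + 2))) hβ (zero_mem_box (d'' + 2) R)
  refine ⟨R, dctIsingPhi (d'' + 2) β (box (d'' + 2) R), hR1, hφ0, hφ, fun N _ hN x hx0 hx =>
    ⟨rotTwoPoint_nonneg hβ _ _, ?_⟩⟩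
  refine (rotTwoPoint_le_dctIsingPhi_pow hβ hN _).trans (pow_le_pow_of_le_one hφ0 hφ.le ?_)
  -- `‖x‖/(4(R+1)) ≤ r/(R+1)` with `r = |x̄|_rot`, from `‖x‖ ≤ 2r`
  have h := supNorm_le_two_mul_rotNorm (d'' := d'') (N := N) hx0 hx
  set r := rotNorm (rotProj d'' N x) with hr
  have hlt : r < (R + 1) * (r / (R + 1) + 1) := Nat.lt_mul_div_succ r (by omega)
  have : Site.supNorm x / (4 * (R + 1)) < r / (R + 1) + 1 := by
    rw [Nat.div_lt_iff_lt_mul (by positivity)]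
    nlinarith
  omega

end Decay

end Literature.Probability.LatticeModels

end
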